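import Literature.AlgebraicGeometry.Morphisms.GeometricPointsLiftSurjective
import Literature.AlgebraicGeometry.Motives.AbelianVarietyTorsionPointsCountProofs
import HarnessLib

/-!
# Points over an algebraically closed field lift along surjective morphisms; divisibility of `A(Ω)`

Layer `Literature/AlgebraicGeometry/Motives`, namespace `Literature.AlgebraicGeometry.Motives`.  THEOREMS ONLY.
Cell hodgecm-mathlib (D-0151), Hecke-link socket (B), Road Ω-3′ «every algebraically closed Ω» (B-plan1 (g14) census
`CENSUS-Qsymplectic-roads` 21242caf): the divisibility feed `hdivA/hdivB` of ★ `AbelianVariety.weilPairingLevel_map_map_eq_of_mixedLevel`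
(p743697) and of ★ `weilPairingLevel_swap/_self` at an ARBITRARY geometric point; the tree had both statements over `ℂ`
only (★ `AlgPoints.map_surjective_of_surjective`, ★ `AbelianVariety.pow_surjective`).  Count-neutral PROOF-lane capital.

* `AlgPoints.map_surjective_of_surjective_of_isAlgClosed` — for a surjective morphism `f : X → Y` of `k`-schemes,
  locally of finite type, and an algebraically closed field `L ⊇ k`, `X(L) → Y(L)` is surjective: the `AlgPoints`
  reading of ★ `Morphisms.exists_over_comp_eq_of_surjective` ([GortzWedhorn2020] Cor. 3.36 / Prop. 4.8);
* `AbelianVariety.map_zsmul_id_apply'` — `[n]` acts on `A(L)` as `P ↦ P^n` (universe-polymorphic restatement);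
* **`AbelianVariety.pow_surjective_of_isAlgClosed`** — `P ↦ P^n` is surjective on `A(Ω)` for `Ω` algebraically closed
  and `n` invertible in `Ω` ([GortzWedhorn2023] Prop. 27.186–27.187: `[n]_A` is an isogeny, ★
  `isIsogeny_zsmul_id_of_cast_ne_zero`); `AbelianVariety.exists_pow_eq_of_isAlgClosed` — pointwise form;
* §3 `ker_powMonoidHom_eq_torsionPoints'`, `natCard_ker_powMonoidHom_eq` (`= n^{2 dim A}` over `Ω` algebraically closed, ★
  `natCard_torsionPoints_eq_of_isAlgClosed`), `finite_ker_powMonoidHom_of_isAlgClosed` — the `powMonoidHom`-kernel currency of H2c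
  (`PolarizationHasTypeOfIsogenyQuotient`, hypothesis `hcount`).

## References

* [GortzWedhorn2020] U. Görtz, T. Wedhorn, *Algebraic Geometry I*, 2nd ed. (2020), Cor. 3.36 (p. 83), Prop. 4.8 (p. 98).
* [GortzWedhorn2023] U. Görtz, T. Wedhorn, *Algebraic Geometry II* (2023), Prop. 27.186 and Prop. 27.187, (27.35.2).
* [MumfordAV1970] D. Mumford, *Abelian Varieties* (1970), §6 Application 3 (Proposition p. 64).
-/

universe u

open CategoryTheory CategoryTheory.Limits AlgebraicGeometry

noncomputable section

namespace Literature.AlgebraicGeometry.Motives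

/-! ### §1 `L`-points lift along surjective morphisms (`L` algebraically closed) -/

/-- **`X(L) → Y(L)` is surjective** for `f : X → Y` surjective and locally of finite type and `L ⊇ k` algebraically
closed (★ `Morphisms.exists_over_comp_eq_of_surjective` at `s = Spec L → Spec k`, read on `AlgPoints X L = (specOver k L ⟶ X)`).
[cite: GortzWedhorn2020, Cor. 3.36 (p. 83) and Prop. 4.8 (p. 98)] -/
theorem AlgPoints.map_surjective_of_surjective_of_isAlgClosed {k : Type u} [Field k] {L : Type u} [Field L]
    [Algebra k L] [IsAlgClosed L] {X Y : SchemeOver k} (f : X ⟶ Y) [LocallyOfFiniteType f.left]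
    [Surjective f.left] : Function.Surjective (AlgPoints.map (L := L) f) := fun Q =>
  Morphisms.exists_over_comp_eq_of_surjective f (Spec.map (CommRingCat.ofHom (algebraMap k L))) Q

/-- The same with the finite-type hypothesis on the structure morphisms of `X` and `Y`.
[cite: GortzWedhorn2020, Cor. 3.36 (p. 83) and Prop. 4.8 (p. 98)] -/
theorem AlgPoints.map_surjective_of_surjective_of_isAlgClosed' {k : Type u} [Field k] {L : Type u} [Field L]
    [Algebra k L] [IsAlgClosed L] {X Y : SchemeOver k} (f : X ⟶ Y) [LocallyOfFiniteType X.hom]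
    [Surjective f.left] : Function.Surjective (AlgPoints.map (L := L) f) := by
  haveI : LocallyOfFiniteType (f.left ≫ Y.hom) := by rw [Over.w f]; infer_instance
  haveI : LocallyOfFiniteType f.left := locallyOfFiniteType_of_comp f.left Y.hom
  exact AlgPoints.map_surjective_of_surjective_of_isAlgClosed f

/-! ### §2 Divisibility of `A(Ω)` -/

namespace AbelianVariety

variable {K : Type u} [Field K] (A : AbelianVariety K)

/-- On `L`-points, `[n]_A = n • 𝟙 A` is the `n`-th power map of the group `A(L)` (universe-polymorphic form of ★
`map_zsmul_id_apply`). [cite: GortzWedhorn2023, (27.35.2)] -/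
theorem map_zsmul_id_apply' (L : Type u) [Field L] [Algebra K L] (n : ℤ) (P : A.Points L) :
    AlgPoints.map ((n • 𝟙 A :).hom.hom.hom) P = P ^ n := by
  rw [AlgPoints.map_apply, hom_zsmul_id, GrpObj.comp_zpow, Category.comp_id]

/-- **`P ↦ P^n` is surjective on `A(Ω)`** for `Ω` algebraically closed and `n` invertible in `Ω`: `[n]_A` is an isogeny
(★ `isIsogeny_zsmul_id_of_cast_ne_zero`), in particular surjective and of finite type, so it is surjective on
`Ω`-points (§1). [cite: GortzWedhorn2023, Prop. 27.186 and Prop. 27.187] -/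
theorem pow_surjective_of_isAlgClosed {Ω : Type u} [Field Ω] [IsAlgClosed Ω] (A : AbelianVariety Ω) (n : ℕ)
    (hn : (n : Ω) ≠ 0) : Function.Surjective fun P : A.Points Ω => P ^ n := by
  have hiso := isIsogeny_zsmul_id_of_cast_ne_zero (A := A) (n : ℤ) (by exact_mod_cast hn)
  haveI : AlgebraicGeometry.Surjective (Hom.toSchemeHom ((n : ℤ) • 𝟙 A)) := hiso.1
  haveI : AlgebraicGeometry.Surjective ((n : ℤ) • 𝟙 A :).hom.hom.hom.left :=
    inferInstanceAs (AlgebraicGeometry.Surjective (Hom.toSchemeHom ((n : ℤ) • 𝟙 A)))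
  have h := AlgPoints.map_surjective_of_surjective_of_isAlgClosed' (L := Ω) (((n : ℤ) • 𝟙 A :).hom.hom.hom)
  intro Q
  obtain ⟨P, hP⟩ := h Q
  refine ⟨P, ?_⟩
  rw [map_zsmul_id_apply', zpow_natCast] at hP
  exact hP

/-- Pointwise form: every `Q ∈ A(Ω)` has an `n`-th root. [cite: GortzWedhorn2023, Prop. 27.186 and Prop. 27.187] -/
theorem exists_pow_eq_of_isAlgClosed {Ω : Type u} [Field Ω] [IsAlgClosed Ω] (A : AbelianVariety Ω) (n : ℕ)
    (hn : (n : Ω) ≠ 0) (Q : A.Points Ω) : ∃ R : A.Points Ω, R ^ n = Q :=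
  A.pow_surjective_of_isAlgClosed n hn Q

/-! ### §3 The kernel of `P ↦ P^n` and its cardinality (appended 2026-08-29, B-p15 (g10); H2c consumer note (n1)) -/

/-- The kernel of `P ↦ P^n` on `A(L)` is the `n`-torsion `A[n](L)` (any field `L ⊇ K`; universe-polymorphic form of ★
`ker_powMonoidHom_eq_torsionPoints`). [cite: GortzWedhorn2023, (27.35.2)] -/
theorem ker_powMonoidHom_eq_torsionPoints' (L : Type u) [Field L] [Algebra K L] (n : ℕ) :
    (powMonoidHom n : A.Points L →* A.Points L).ker = A.torsionPoints L n := by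
  ext P
  rw [MonoidHom.mem_ker, powMonoidHom_apply, mem_torsionPoints_iff, zpow_natCast]

/-- **`|ker (P ↦ P^n)| = n^{2 dim A}` on `A(Ω)`** for `Ω ⊇ K` algebraically closed and `n` invertible in `K` (★
`natCard_torsionPoints_eq_of_isAlgClosed`, Mumford §6 App. 3, read on the kernel of `powMonoidHom n`).
[cite: MumfordAV1970, §6 Application 3 (Proposition p. 64)] -/
theorem natCard_ker_powMonoidHom_eq (L : Type u) [Field L] [Algebra K L] [IsAlgClosed L] (n : ℕ) (hn : (n : K) ≠ 0) :
    Nat.card (powMonoidHom n : A.Points L →* A.Points L).ker = n ^ (2 * A.dim) := by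
  rw [ker_powMonoidHom_eq_torsionPoints']
  have h := A.natCard_torsionPoints_eq_of_isAlgClosed L (n : ℤ) (by exact_mod_cast hn)
  rwa [Int.natAbs_natCast] at h

/-- `ker (P ↦ P^n)` on `A(Ω)` is finite (`Ω` algebraically closed, `n` invertible in `K`).
[cite: MumfordAV1970, §6 Application 3 (Proposition p. 64)] -/
theorem finite_ker_powMonoidHom_of_isAlgClosed (L : Type u) [Field L] [Algebra K L] [IsAlgClosed L] (n : ℕ) (hn : (n : K) ≠ 0) :
    Finite (powMonoidHom n : A.Points L →* A.Points L).ker := by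
  have hn0 : n ≠ 0 := by rintro rfl; exact hn (by simp)
  apply Nat.finite_of_card_ne_zero
  rw [A.natCard_ker_powMonoidHom_eq L n hn]
  exact pow_ne_zero _ hn0

/-! ### §4 Divisibility keyed on the DOMINANCE of `[N]` (appended 2026-08-30, A-p07 (g12); the `hdiv` feed of the level-adjoint calculus) -/

/-- **`P ↦ P^N` is surjective on `A(Ω)` whenever `[N]_A` is DOMINANT** (`Ω` algebraically closed) — the exact shape of the divisibility
hypotheses `hdiv`/`hA`/`hB` of ★ `AbelianVarietyLevelAdjointCalculus` / ★ `JacobianCorrespondenceLevelAdjoint`, which are keyed on the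
instance `[IsDominant [N]_A]` rather than on `(N : Ω) ≠ 0`: a homomorphism of abelian varieties is proper (★ `isProper_toSchemeHom`), so a
dominant one has closed dense image and is surjective (Mathlib `surjective_of_isDominant_of_isClosed_range`), hence onto on `Ω`-points
(§1); and `[N]` acts on `A(Ω)` as `P ↦ P^N`.  Use: `hdiv := fun N _ => A.pow_surjective_of_isDominant N`.
[cite: GortzWedhorn2023, Prop. 27.186 and Prop. 27.187] [cite: MumfordAV1970, §6 Application 2 (p. 62)] -/
theorem pow_surjective_of_isDominant {Ω : Type u} [Field Ω] [IsAlgClosed Ω] (A : AbelianVariety Ω) (N : ℕ)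
    [IsDominant (Hom.toSchemeHom ((N : ℤ) • 𝟙 A))] : Function.Surjective fun P : A.Points Ω => P ^ N := by
  haveI : IsProper (Hom.toSchemeHom ((N : ℤ) • 𝟙 A)) := isProper_toSchemeHom _
  haveI : AlgebraicGeometry.Surjective (Hom.toSchemeHom ((N : ℤ) • 𝟙 A)) :=
    surjective_of_isDominant_of_isClosed_range _ (Hom.toSchemeHom ((N : ℤ) • 𝟙 A)).isClosedMap.isClosed_range
  haveI : AlgebraicGeometry.Surjective ((N : ℤ) • 𝟙 A :).hom.hom.hom.left :=
    inferInstanceAs (AlgebraicGeometry.Surjective (Hom.toSchemeHom ((N : ℤ) • 𝟙 A)))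
  have h := AlgPoints.map_surjective_of_surjective_of_isAlgClosed' (L := Ω) (((N : ℤ) • 𝟙 A :).hom.hom.hom)
  intro Q
  obtain ⟨P, hP⟩ := h Q
  refine ⟨P, ?_⟩
  rw [map_zsmul_id_apply', zpow_natCast] at hP
  exact hP

/-- The same as a `∀ N`-package, literally the hypothesis `hdiv : ∀ N [IsDominant [N]_A], Function.Surjective (P ↦ P^N)` of ★
`levelAdjoint_pushPull` / `levelAdjoint_pushforward_of_dominated` / `levelAdjoint_reverse` over an algebraically closed field.
[cite: GortzWedhorn2023, Prop. 27.186 and Prop. 27.187] [cite: MumfordAV1970, §6 Application 2 (p. 62)] -/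
theorem forall_pow_surjective_of_isDominant {Ω : Type u} [Field Ω] [IsAlgClosed Ω] (A : AbelianVariety Ω) :
    ∀ (N : ℕ) [IsDominant (Hom.toSchemeHom ((N : ℤ) • 𝟙 A))], Function.Surjective fun P : A.Points Ω => P ^ N :=
  fun N _ => A.pow_surjective_of_isDominant N

end AbelianVariety

end Literature.AlgebraicGeometry.Motives

end
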